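import Literature.Geometry.Lorentzian.CauchyDevelopmentGlobalHyperbolicityProofs
import Literature.Geometry.Lorentzian.CauchyDevelopmentAcausal
import Literature.Geometry.Lorentzian.CauchyDevelopmentCausal
import Literature.Geometry.Lorentzian.CausalityClosure
import Literature.Geometry.Lorentzian.CausalityPushUp
import HarnessLib

/-!
# Causal pasts in a Cauchy development: outer semicontinuity against closed sets above the data
# hypersurface, and `J⁻(c) ∩ J⁺(ι X) = {c}` — bricks for the Killing PROPAGATION step β'
# (`stub_killingPropagation'`, K1a) of the line `direct-method-on-the-cone`, crux
# `BondiBartnikRigidity` (stmt-FinalStateConjecture-10807); worker betaA of lead c3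

Two consequences of the global hyperbolicity of Cauchy developments (compact sets
`J⁻(x) ∩ J⁺(ι X)`, Hawking–Ellis 1973, Prop. 6.6.6; closed causal relation, O'Neill 1983,
Lemma 14.22; acausality of the data hypersurface, Lemma 14.42), used by the conditional closer
`…KillingPropagationOfFacts.lean` (openness of the past set `P`, the entry of timelike curves into
`P`, and the attachment of the exact diamond to the collar):

* `exists_nhds_causalPast_inter_eq_empty` — if `J⁻(y)` misses a closed set `F ⊆ J⁺(ι X)`, so does
  `J⁻(y')` for all `y'` near `y` (registered brick `stub_killingPropagation_causalPastSemicontinuous`,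
  its dimension-`3 + 1` instance, signature verbatim);
* `causalPast_inter_causalFuture_range_embed` — `J⁻(c) ∩ J⁺(ι X) ⊆ {c}` for `c ∈ ι(X)`.

Everything is proved; no definitions, no named facts.  References: [HawkingEllis1973CUP] §6.6,
Prop. 6.6.6; [ONeillSemiRiemannian1983] Ch. 14, Lemma 14.22, Lemma 14.42.
-/

noncomputable section

-- D-0017: single-problem summit, `Summit.<S>.<S>.…` by design (cf. lakefile `weak.linter.dupNamespace`).
set_option linter.dupNamespace false

open Set Filter Function Topology TopologicalSpace Bundle
open Literature.Geometry.Lorentzian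
open scoped Manifold ContDiff Topology

namespace Summit.FinalStateConjecture.FinalStateConjecture.Theorems.BondiBartnikRigidity.DirectMethod

namespace KillingPropagation

section Development

variable {n : ℕ} {X : Type*} [TopologicalSpace X] [ChartedSpace (EuclideanSpace ℝ (Fin n)) X]
  [IsManifold (𝓡 n) ∞ X] [ConnectedSpace X] {D : InitialDataSet (𝓡 n) X}

/-- **Outer semicontinuity of causal pasts against closed sets above the data hypersurface.** In a
Cauchy development, if the causal past `J⁻(y)` misses a closed set `F ⊆ J⁺(ι X)`, then so does
`J⁻(y')` for all `y'` near `y`: otherwise `xₖ ≤ yₖ → y` with `xₖ ∈ F`; for `y ≪ c` the `xₖ` lie in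
the compact set `J⁻(c) ∩ J⁺(ι X)` (Hawking–Ellis 1973, Prop. 6.6.6), a subsequence converges to
some `x ∈ F`, and `x ≤ y` by the closedness of the causal relation (O'Neill 1983, Lemma 14.22).
[cite: HawkingEllis1973CUP, §6.6, Prop. 6.6.6 (p. 211)] -/
theorem exists_nhds_causalPast_inter_eq_empty (𝒟 : CauchyDevelopment D) {F : Set 𝒟.carrier}
    (hF : IsClosed F) (hFS : F ⊆ 𝒟.metric.causalFuture 𝒟.timeOrientation (range 𝒟.embed))
    {y : 𝒟.carrier} (hy : 𝒟.metric.causalPast 𝒟.timeOrientation {y} ∩ F = ∅) :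
    ∃ W ∈ 𝓝 y, ∀ y' ∈ W, 𝒟.metric.causalPast 𝒟.timeOrientation {y'} ∩ F = ∅ := by
  classical
  set g := 𝒟.metric
  set τ := 𝒟.timeOrientation
  have hn2 : (2 : ℕ∞ω) ≤ ((⊤ : ℕ∞) : ℕ∞ω) := WithTop.coe_le_coe.mpr le_top
  -- a point `c ≫ y` and the open neighbourhood `I⁻(c)` of `y`
  obtain ⟨μ, ε, hε, hμ0, hμ⟩ := g.exists_isFutureTimelikeCurveOn_Ioo_of_isInteriorPoint τ
    (BoundarylessManifold.isInteriorPoint (I := 𝓡 (n + 1)) (x := y))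
  set c := μ (ε / 2) with hc
  have hyc : c ∈ g.chronologicalFuture τ {y} :=
    ⟨y, rfl, μ, 0, ε / 2, by positivity, hμ.mono (Icc_subset_Ioo (by linarith) (by linarith)), hμ0, rfl⟩
  have hyc' : y ∈ g.chronologicalPast τ {c} :=
    LorentzianMetric.mem_chronologicalPast_of_mem_chronologicalFuture hyc
  have hIo : IsOpen (g.chronologicalPast τ {c}) :=
    LorentzianMetric.isOpen_chronologicalPast_of_boundaryless g τ {c}
  by_contra hcon
  push Not at hcon
  -- a sequence `yₖ → y` inside `I⁻(c)` with `J⁻(yₖ) ∩ F ≠ ∅`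
  have hfreq : ∃ᶠ y' in 𝓝 y, y' ∈ g.chronologicalPast τ {c} ∧
      (g.causalPast τ {y'} ∩ F).Nonempty := by
    rw [Filter.frequently_iff]
    intro W hW
    obtain ⟨y', hy'W, hy'⟩ := hcon (W ∩ g.chronologicalPast τ {c}) (inter_mem hW (hIo.mem_nhds hyc'))
    exact ⟨y', hy'W.1, hy'W.2, hy'⟩
  obtain ⟨ys, hys, hys'⟩ := exists_seq_forall_of_frequently hfreq
  choose xs hxs using fun k ↦ (hys' k).2
  -- the `xₖ` lie in the compact set `J⁻(c) ∩ J⁺(ι X)`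
  set K := g.causalPast τ {c} ∩ g.causalFuture τ (range 𝒟.embed) with hK
  have hKc : IsCompact K := 𝒟.isCompact_causalPast_inter_causalFuture_range c
  have hxK : ∀ k, xs k ∈ K := by
    intro k
    refine ⟨?_, hFS (hxs k).2⟩
    -- `xₖ ≤ yₖ ≪ c`
    have h1 : ys k ∈ g.causalFuture τ {xs k} :=
      LorentzianMetric.mem_causalPast_singleton_iff.1 (hxs k).1
    have h2 : c ∈ g.causalFuture τ {ys k} :=
      LorentzianMetric.chronologicalFuture_subset_causalFuture g τ _
        (LorentzianMetric.mem_chronologicalFuture_of_mem_chronologicalPast (hys' k).1)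
    exact LorentzianMetric.mem_causalPast_singleton_iff.2
      (LorentzianMetric.mem_causalFuture_of_mem_causalFuture_of_mem_causalFuture hn2 h1 h2)
  obtain ⟨x, hxKm, φ, hφ, hxlim⟩ := hKc.tendsto_subseq hxK
  have hxF : x ∈ F := hF.mem_of_tendsto hxlim (Eventually.of_forall fun k ↦ (hxs (φ k)).2)
  have hxy : y ∈ g.causalFuture τ {x} :=
    𝒟.mem_causalFuture_of_tendsto hxlim (hys.comp hφ.tendsto_atTop) fun k ↦
      LorentzianMetric.mem_causalPast_singleton_iff.1 (hxs (φ k)).1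
  have : x ∈ g.causalPast τ {y} ∩ F := ⟨LorentzianMetric.mem_causalPast_singleton_iff.2 hxy, hxF⟩
  rw [hy] at this
  exact this

/-- **`J⁻(c) ∩ J⁺(ι X) = {c}` for a point `c` of the data hypersurface**: if `σ ≤ x ≤ c` with
`σ, c ∈ ι(X)`, then `σ = c` by acausality of `ι(X)` (O'Neill 1983, Lemma 14.42), and `x = c` since a
Cauchy development contains no closed causal curve. [cite: ONeillSemiRiemannian1983, Ch. 14, Lemma 14.42 (p. 425)] -/
theorem causalPast_inter_causalFuture_range_embed (𝒟 : CauchyDevelopment D) {c : 𝒟.carrier}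
    (hc : c ∈ range 𝒟.embed) :
    𝒟.metric.causalPast 𝒟.timeOrientation {c} ∩
      𝒟.metric.causalFuture 𝒟.timeOrientation (range 𝒟.embed) ⊆ {c} := by
  intro x hx
  have hn2 : (2 : ℕ∞ω) ≤ ((⊤ : ℕ∞) : ℕ∞ω) := WithTop.coe_le_coe.mpr le_top
  have hn1 : (1 : ℕ∞ω) ≤ ((⊤ : ℕ∞) : ℕ∞ω) := le_trans one_le_two hn2
  obtain ⟨hxc, hxS⟩ := hx
  have hcx : c ∈ 𝒟.metric.causalFuture 𝒟.timeOrientation {x} :=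
    LorentzianMetric.mem_causalPast_singleton_iff.1 hxc
  rw [LorentzianMetric.causalFuture_eq_biUnion] at hxS
  simp only [mem_iUnion, exists_prop] at hxS
  obtain ⟨σ, hσ, hxσ⟩ := hxS
  have hcσ : c ∈ 𝒟.metric.causalFuture 𝒟.timeOrientation {σ} :=
    LorentzianMetric.mem_causalFuture_of_mem_causalFuture_of_mem_causalFuture hn2 hxσ hcx
  have hσc : c = σ := 𝒟.eq_of_mem_causalFuture_range_embed σ hσ c hc hcσ
  subst hσc
  -- `c ≤ x ≤ c`: equal, or a closed causal curve
  rw [mem_singleton_iff]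
  by_contra hne
  rcases hxσ with hxσ | ⟨c', hc', γ₁, a₁, b₁, hab₁, hγ₁, hγ₁a, hγ₁b⟩
  · exact hne (mem_singleton_iff.1 hxσ)
  rw [mem_singleton_iff] at hc'
  subst hc'
  rcases hcx with hcx | ⟨x', hx', γ₂, a₂, b₂, hab₂, hγ₂, hγ₂a, hγ₂b⟩
  · exact hne (mem_singleton_iff.1 hcx).symm
  rw [mem_singleton_iff] at hx'
  subst hx'
  obtain ⟨γ, a, b, hab, hγ, hγa, hγb⟩ :=
    LorentzianMetric.exists_isFutureCausalCurveOn_trans hn1 hab₁ hab₂ hγ₁ hγ₂ (hγ₁b.trans hγ₂a.symm)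
  exact 𝒟.isCausallyWellBehaved γ a b hab hγ (by rw [hγa, hγb, hγ₁a, hγ₂b])

end Development

end KillingPropagation

open KillingPropagation in
/-- **Registered brick `stub_killingPropagation_causalPastSemicontinuous` of
`stub_killingPropagation'` (K1a β')**: outer semicontinuity of causal pasts against closed sets
above the data hypersurface of a Cauchy development in dimension `3 + 1`
(instance of `exists_nhds_causalPast_inter_eq_empty`). [cite: HawkingEllis1973CUP, §6.6, Prop. 6.6.6 (p. 211)] -/
theorem stub_killingPropagation_causalPastSemicontinuous : ∀ (X : Type) [TopologicalSpace X] [ChartedSpace E3 X] [IsManifold (𝓡 3) ∞ X] [T2Space X] [SecondCountableTopology X] [ConnectedSpace X] (D : InitialDataSet (𝓡 3) X) (𝒟 : CauchyDevelopment D) (F : Set 𝒟.carrier) (y : 𝒟.carrier), IsClosed F → F ⊆ 𝒟.metric.causalFuture 𝒟.timeOrientation (range 𝒟.embed) → 𝒟.metric.causalPast 𝒟.timeOrientation {y} ∩ F = ∅ → ∃ W ∈ 𝓝 y, ∀ y' ∈ W, 𝒟.metric.causalPast 𝒟.timeOrientation {y'} ∩ F = ∅ :=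
  fun _ _ _ _ _ _ _ _ 𝒟 _ _ hF hFS hy ↦ exists_nhds_causalPast_inter_eq_empty 𝒟 hF hFS hy

end Summit.FinalStateConjecture.FinalStateConjecture.Theorems.BondiBartnikRigidity.DirectMethod

end
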